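import Summits.Langlands.Langlands.Theorems.PicardMuOrdinaryMuOrdinaryFamilyRTPointDescent
import Literature.NumberTheory.GaloisRepresentations.NearlyOrdinaryDeformationHensel
import Mathlib.RingTheory.AdicCompletion.Topology

/-!
# The Picard point of line `free-seed-smooth-rt` (crux `MuOrdinaryFamilyRT`, stmt-Langlands-13757):
# LEAF `modelCore` — Carayol–Serre descent of `ρ_C` to `𝒪₀ = ℤ₃[ζ₃]` with exact reduction `r̄_f^B`

Helper file for the registered stub `stub_point` (plan: `…PointPlan.lean`).  PROVED:
`theorem modelCore : Leaf.modelCore`.  Given the integral model `ρ_A : Γ_K → GL₃(𝒪_{E₁})` of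
`…PointDescent.lean` (traces in `E₀`, absolutely irreducible reduction, residual traces = heart traces):

* `inclO`, `inclOEquiv`, `mem_range_inclO` — `𝒪₀ ≅ A₀ := 𝒪_{E₁} ∩ E₀`, with `isLocalRing_range`,
  `isNoetherianRing_range`, `isAdicComplete_range` (transport along the ring isomorphism, Mathlib
  `IsAdicComplete.congr_ringEquiv`), `isLocalHom_subtype`, `residue_inclO` (the two residue maps agree);
* Carayol–Serre descent `F2` gives `ρ₀' : Γ_K → GL₃(A₀)` conjugate to `ρ_A` in `GL₃(𝒪_{E₁})`, transported to
  `ρ₀ : Γ_K → GL₃(𝒪₀)`; its reduction has the traces of `r̄_f^B` (injectivity of `𝔽₃ → 𝒪_{E₁}/𝔪`), so by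
  `F3` over `𝔽₃` (against `r̄_f^B`, absolutely irreducible) it is `Q r̄_f^B Q⁻¹`; lifting `Q` to `GL₃(𝒪₀)`
  (`Deformation.exists_generalLinearGroup_map_eq`) and conjugating gives `ρ₁` reducing EXACTLY to `r̄_f^B`;
* `ρ₁` is conjugate to `ρ` over `ℚ̄₃` (bookkeeping of the four conjugations) and `𝔪`-adically continuous
  (`ker(ρ₁ mod 𝔪₀^m) ⊇ ker(ρ_A mod 𝔪^M)` for `‖ϖ‖^M < ‖ϖ₀‖^m`, `mem_ker_map_mk_iff`, `conj_sub_one_mem`).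
-/

-- `Summit.Langlands.Langlands.…` (summit = sub-problem name, D-0017 layout) trips `dupNamespace` on every decl.
set_option linter.dupNamespace false

namespace Summit.Langlands.Langlands.Cruxes.MuOrdinaryFamilyRT.FreeSeedSmoothRt

open scoped NumberField Polynomial Matrix Classical
open Field IsDedekindDomain IsLocalRing Metric
open Literature.NumberTheory.GaloisRepresentations

noncomputable section

/-! ### `𝒪₀ → 𝒪_{E₁}` for `E₀ ≤ E₁`, and its image `A₀` -/

section Inclusion

variable (ι : PadicAlgCl 3 ≃+* ℂ) (e : K →+* ℂ) {E₁ : IntermediateField ℚ_[3] (PadicAlgCl 3)} (hle : E₀ ι e ≤ E₁)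

/-- The inclusion `𝒪₀ = 𝒪_{E₀} → 𝒪_{E₁}`. -/
def inclO : O₀ ι e →+* intermediateFieldIntegers 3 E₁ :=
  (((IntermediateField.inclusion hle).toRingHom).comp (intermediateFieldIntegers 3 (E₀ ι e)).subtype).codRestrict
    (intermediateFieldIntegers 3 E₁) fun x => by
      rw [mem_intermediateFieldIntegers_iff]
      exact (mem_intermediateFieldIntegers_iff _ _).mp x.2

/-- `inclO` on underlying elements of `ℚ̄₃`. -/
@[simp] theorem jInt_inclO (x : O₀ ι e) : jInt E₁ (inclO ι e hle x) = j₀ ι e x := rfl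

/-- `inclO` is injective. -/
theorem inclO_injective : Function.Injective (inclO ι e hle) := fun x y h =>
  j₀_injective ι e (by rw [← jInt_inclO ι e hle, ← jInt_inclO ι e hle, h])

/-- `𝒪₀ ≅ A₀ := inclO(𝒪₀) ⊆ 𝒪_{E₁}`. -/
def inclOEquiv : O₀ ι e ≃+* (inclO ι e hle).range :=
  RingEquiv.ofBijective (inclO ι e hle).rangeRestrict
    ⟨fun _ _ h => inclO_injective ι e hle (Subtype.ext_iff.mp h), RingHom.rangeRestrict_surjective _⟩

/-- `inclOEquiv` on underlying elements. -/
@[simp] theorem coe_inclOEquiv (x : O₀ ι e) : ((inclOEquiv ι e hle x : (inclO ι e hle).range) : intermediateFieldIntegers 3 E₁) = inclO ι e hle x :=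
  rfl

/-- An element of `𝒪_{E₁}` lying in `E₀` comes from `𝒪₀`. -/
theorem mem_range_inclO {a : intermediateFieldIntegers 3 E₁} (ha : jInt E₁ a ∈ E₀ ι e) : a ∈ (inclO ι e hle).range := by
  have hn : (⟨jInt E₁ a, ha⟩ : E₀ ι e) ∈ intermediateFieldIntegers 3 (E₀ ι e) := by
    rw [mem_intermediateFieldIntegers_iff]
    exact (mem_intermediateFieldIntegers_iff _ _).mp a.2
  refine ⟨⟨⟨jInt E₁ a, ha⟩, hn⟩, Subtype.ext (Subtype.ext rfl)⟩

/-- `A₀` is local. -/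
theorem isLocalRing_range : IsLocalRing (inclO ι e hle).range :=
  IsLocalRing.of_surjective' (inclOEquiv ι e hle).toRingHom (inclOEquiv ι e hle).surjective

/-- `A₀` is Noetherian. -/
theorem isNoetherianRing_range : IsNoetherianRing (inclO ι e hle).range :=
  isNoetherianRing_of_ringEquiv (O₀ ι e) (inclOEquiv ι e hle)

/-- `A₀` is `𝔪`-adically complete. -/
theorem isAdicComplete_range [FiniteDimensional ℚ_[3] E₁] :
    haveI := isLocalRing_range ι e hle
    IsAdicComplete (maximalIdeal (inclO ι e hle).range) (inclO ι e hle).range := by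
  haveI := isLocalRing_range ι e hle
  rw [← map_ringEquiv_maximalIdeal (inclOEquiv ι e hle)]
  exact (IsAdicComplete.congr_ringEquiv _ (inclOEquiv ι e hle)).mpr inferInstance

/-- `A₀ ⊆ 𝒪_{E₁}` is a local inclusion (`𝔪_{A₀} = 𝔪 ∩ A₀`). -/
theorem isLocalHom_subtype : IsLocalHom (inclO ι e hle).range.subtype := by
  refine ⟨fun a ha => ?_⟩
  obtain ⟨x, rfl⟩ := (inclOEquiv ι e hle).surjective a
  refine (IsUnit.map (inclOEquiv ι e hle) ?_)
  rw [intermediateFieldIntegers.isUnit_iff_norm_eq_one, intermediateFieldIntegers.norm_coe, ← j₀_apply]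
  rw [intermediateFieldIntegers.isUnit_iff_norm_eq_one, intermediateFieldIntegers.norm_coe] at ha
  exact ha

/-- The residue of an element of `A₀` is the residue of its preimage in `𝒪₀`, read in `𝔽₃`. -/
theorem residue_inclO (x : O₀ ι e) :
    letI := algebraZModResidueField E₁
    residue (intermediateFieldIntegers 3 E₁) (inclO ι e hle x) =
      algebraMap (ZMod 3) (ResidueField (intermediateFieldIntegers 3 E₁)) (algebraMap (O₀ ι e) (ZMod 3) x) := by
  letI := algebraZModResidueField E₁
  obtain ⟨n, hn⟩ := exists_nat_sub_mem_maximalIdeal ι e x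
  have h1 : residue (intermediateFieldIntegers 3 E₁) (inclO ι e hle (x - n)) = 0 := by
    rw [residue_eq_zero_iff, intermediateFieldIntegers.mem_maximalIdeal_iff, intermediateFieldIntegers.norm_coe,
      ← jInt_apply, jInt_inclO]
    exact (mem_maximalIdeal_O₀_iff ι e _).mp hn
  have h2 : algebraMap (O₀ ι e) (ZMod 3) (x - n) = 0 := by
    rw [← RingHom.mem_ker, ker_algebraMap_O₀_ZMod]; exact hn
  rw [map_sub (inclO ι e hle)] at h1
  rw [map_sub (residue (intermediateFieldIntegers 3 E₁)), sub_eq_zero, map_natCast, map_natCast] at h1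
  rw [map_sub, sub_eq_zero, map_natCast] at h2
  rw [h1, h2, map_natCast]

end Inclusion

/-! ### LEAF `modelCore` -/

set_option maxHeartbeats 1600000 in
/-- **LEAF `modelCore`** (registered helper goal of `stub_point`): lattice, Carayol–Serre descent of `ρ_C`
to `𝒪₀`, exact reduction `r̄_f^B`, `𝔪`-adic continuity.  (Heartbeats raised: the unit groups of `3 × 3`
matrices over valuation subrings of intermediate fields make instance unification slow.) -/
theorem modelCore : Leaf.modelCore := by
  intro f ι e B hgen hF2 hF3 ρ h1
  have hirr := rbarAbsIrreducible f B hgen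
  obtain ⟨E₁, hfin, hle, ρA, P, hconj, hcont, htr₀, hres, habs⟩ := exists_integralModel_E₁ hgen B hirr hF3 ρ h1
  haveI := hfin
  haveI : IsLocalRing (inclO ι e hle).range := isLocalRing_range ι e hle
  haveI : IsNoetherianRing (inclO ι e hle).range := isNoetherianRing_range ι e hle
  haveI : IsAdicComplete (maximalIdeal (inclO ι e hle).range) (inclO ι e hle).range := isAdicComplete_range ι e hle
  haveI : Finite (ResidueField (intermediateFieldIntegers 3 E₁)) := intermediateFieldIntegers.finite_residueField E₁
  -- (1) Carayol–Serre descent to `A₀ ≅ 𝒪₀`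
  have htrA : ∀ g, (ρA g).val.trace ∈ (inclO ι e hle).range := fun g => mem_range_inclO ι e hle (htr₀ g)
  obtain ⟨ρ₀', P₄, hP₄⟩ := hF2 (intermediateFieldIntegers 3 E₁) (inclO ι e hle).range (isLocalHom_subtype ι e hle) (absoluteGaloisGroup K) 3 ρA habs htrA
  obtain ⟨ρ₀, hρ₀⟩ : ∃ ρ₀ : absoluteGaloisGroup K →* GL (Fin 3) (O₀ ι e),
      ρ₀ = (Matrix.GeneralLinearGroup.map (inclOEquiv ι e hle).symm.toRingHom).comp ρ₀' := ⟨_, rfl⟩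
  have hρ₀' : ∀ g, ρ₀' g = Matrix.GeneralLinearGroup.map (inclOEquiv ι e hle).toRingHom (ρ₀ g) := fun g => by
    rw [hρ₀, MonoidHom.comp_apply]
    exact Units.ext (Matrix.ext fun i j => ((inclOEquiv ι e hle).apply_symm_apply _).symm)
  -- (2) the residual traces of `ρ₀` are those of the heart
  letI := algebraZModResidueField E₁
  haveI := charP_residueField E₁
  have hcastinj : Function.Injective (algebraMap (ZMod 3) (ResidueField (intermediateFieldIntegers 3 E₁))) :=
    (algebraMap (ZMod 3) (ResidueField (intermediateFieldIntegers 3 E₁))).injective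
  have hcast : ∀ x : ZMod 3, (x.cast : ResidueField (intermediateFieldIntegers 3 E₁)) = algebraMap (ZMod 3) (ResidueField (intermediateFieldIntegers 3 E₁)) x := fun x => by
    change _ = ZMod.castHom (dvd_refl 3) (ResidueField (intermediateFieldIntegers 3 E₁)) x
    rw [ZMod.castHom_apply]
  have hsq : ∀ x : O₀ ι e, residue (intermediateFieldIntegers 3 E₁) (((inclO ι e hle).range.subtype.comp (inclOEquiv ι e hle).toRingHom) x) =
      algebraMap (ZMod 3) (ResidueField (intermediateFieldIntegers 3 E₁)) (algebraMap (O₀ ι e) (ZMod 3) x) := fun x => residue_inclO ι e hle x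
  have htr_red : ∀ g, ((Matrix.GeneralLinearGroup.map (algebraMap (O₀ ι e) (ZMod 3))).comp ρ₀ g).val.trace =
      (rbar f B g).val.trace := by
    intro g
    apply hcastinj
    rw [MonoidHom.comp_apply, trace_generalLinearGroup_map, ← hsq, RingHom.comp_apply, ← trace_generalLinearGroup_map,
      ← hρ₀', ← trace_generalLinearGroup_map (inclO ι e hle).range.subtype]
    have : Matrix.GeneralLinearGroup.map (inclO ι e hle).range.subtype (ρ₀' g) = P₄⁻¹ * ρA g * P₄ := by
      rw [hP₄ g, ← mul_assoc, ← mul_assoc, inv_mul_cancel, one_mul, inv_mul_cancel_right]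
    rw [this, Units.val_mul, Units.val_mul, Matrix.trace_units_conj', hres, hcast]
  -- (3) exact reduction: conjugate by a lift of the matrix given by `F3` over `𝔽₃`
  haveI : IsAdicComplete (maximalIdeal (ZMod 3)) (ZMod 3) := isAdicComplete_field _
  obtain ⟨Q, hQ⟩ := hF3 (ZMod 3) (absoluteGaloisGroup K) 3 (rbar f B)
    ((Matrix.GeneralLinearGroup.map (algebraMap (O₀ ι e) (ZMod 3))).comp ρ₀) (IsAbsIrreducible.comp_map hirr _) htr_red
  obtain ⟨Qt, hQt⟩ := Deformation.exists_generalLinearGroup_map_eq (algebraMap_O₀_ZMod_surjective ι e) Q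
  obtain ⟨ρ₁, hρ₁⟩ : ∃ ρ₁ : absoluteGaloisGroup K →* GL (Fin 3) (O₀ ι e),
      ρ₁ = (MulAut.conj Qt⁻¹).toMonoidHom.comp ρ₀ := ⟨_, rfl⟩
  have hρ₁g : ∀ g, ρ₁ g = Qt⁻¹ * ρ₀ g * Qt := fun g => by
    rw [hρ₁, MonoidHom.comp_apply, MulEquiv.coe_toMonoidHom, MulAut.conj_apply, inv_inv]
  have hred : ∀ g, (ρ₁ g).val.map (algebraMap (O₀ ι e) (ZMod 3)) = (rbar f B g).val := by
    intro g
    have h := hQ g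
    rw [MonoidHom.comp_apply] at h
    have : Matrix.GeneralLinearGroup.map (algebraMap (O₀ ι e) (ZMod 3)) (ρ₁ g) = rbar f B g := by
      rw [hρ₁g, map_mul, map_mul, map_inv, hQt, h, ← mul_assoc, ← mul_assoc, inv_mul_cancel, one_mul,
        inv_mul_cancel_right]
    exact congrArg Units.val this
  refine ⟨ρ₁, P * Matrix.GeneralLinearGroup.map (jInt E₁) P₄ * Matrix.GeneralLinearGroup.map (j₀ ι e) Qt, ?_, hred, ?_⟩
  · -- (4) conjugacy over `ℚ̄₃`
    intro g
    have hj : ∀ x : O₀ ι e, jInt E₁ ((inclO ι e hle).range.subtype ((inclOEquiv ι e hle).toRingHom x)) = j₀ ι e x := fun x => rfl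
    have h0 : Matrix.GeneralLinearGroup.map (jInt E₁) (Matrix.GeneralLinearGroup.map (inclO ι e hle).range.subtype (ρ₀' g)) =
        Matrix.GeneralLinearGroup.map (j₀ ι e) (ρ₀ g) := by
      rw [hρ₀']
      exact Units.ext (Matrix.ext fun i j => hj _)
    have hρ₀g : ρ₀ g = Qt * ρ₁ g * Qt⁻¹ := by
      rw [hρ₁g, ← mul_assoc, ← mul_assoc, mul_inv_cancel, one_mul, mul_inv_cancel_right]
    rw [hconj g, hP₄ g, map_mul, map_mul, map_inv, h0, hρ₀g, map_mul, map_mul, map_inv]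
    simp only [mul_assoc, mul_inv_rev]
  · -- (5) `𝔪`-adic continuity, from that of `ρ_A`
    intro m
    obtain ⟨M, hM⟩ := exists_pow_lt_of_lt_one (pow_pos (intermediateFieldIntegers.norm_uniformizer_pos (E₀ ι e)) m)
      (intermediateFieldIntegers.norm_uniformizer_lt_one E₁)
    refine Subgroup.isOpen_mono ?_ (hcont M)
    intro g hg
    rw [mem_ker_map_mk_iff] at hg ⊢
    have hX : P₄⁻¹ * ρA g * P₄ = Matrix.GeneralLinearGroup.map (inclO ι e hle).range.subtype (ρ₀' g) := by
      rw [hP₄ g, ← mul_assoc, ← mul_assoc, inv_mul_cancel, one_mul, inv_mul_cancel_right]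
    have hg' : ∀ i j, (Matrix.GeneralLinearGroup.map (inclO ι e hle).range.subtype (ρ₀' g)).val i j -
        (1 : Matrix (Fin 3) (Fin 3) (intermediateFieldIntegers 3 E₁)) i j ∈ maximalIdeal (intermediateFieldIntegers 3 E₁) ^ M := by
      rw [← hX]
      exact conj_sub_one_mem _ _ P₄ hg
    intro i j
    -- the `(i, j)` entry of `ρ₀ g - 1`, in `𝒪₀`
    have hentry : ∀ i j, (ρ₀ g).val i j - (1 : Matrix (Fin 3) (Fin 3) (O₀ ι e)) i j ∈ maximalIdeal (O₀ ι e) ^ m := by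
      intro i j
      rw [intermediateFieldIntegers.mem_maximalIdeal_pow_iff, intermediateFieldIntegers.norm_coe, ← j₀_apply]
      have hx := hg' i j
      rw [intermediateFieldIntegers.mem_maximalIdeal_pow_iff] at hx
      refine le_trans ?_ (le_trans hx hM.le)
      apply le_of_eq
      rw [intermediateFieldIntegers.norm_coe, ← jInt_apply, map_sub, map_sub, hρ₀']
      have h1 : j₀ ι e ((1 : Matrix (Fin 3) (Fin 3) (O₀ ι e)) i j) =
          jInt E₁ ((1 : Matrix (Fin 3) (Fin 3) (intermediateFieldIntegers 3 E₁)) i j) := by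
        by_cases hij : i = j
        · subst hij; simp
        · simp [Matrix.one_apply_ne hij]
      rw [h1]
      rfl
    rw [hρ₁g]
    exact conj_sub_one_mem _ _ Qt hentry i j

end

end Summit.Langlands.Langlands.Cruxes.MuOrdinaryFamilyRT.FreeSeedSmoothRt
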